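import Summits.BirchSwinnertonDyer.BirchSwinnertonDyer.Theorems.PAdicOrderV2PadicBSDrankOrderEqCorankOdd
import Literature.NumberTheory.EllipticCurves.SelmerCorankControlProofs
import Literature.NumberTheory.EllipticCurves.SelmerCorankHolds

/-!
# BirchSwinnertonDyer / PAdicOrderV2 — crux `PAdicOrderPadicBSDrankR2` (stmt-0490), line `Sketch`:
# the split of the crux along the Selmer side is EXACT (helper, `--supports`)

Line `Sketch` proves the crux `S` (`ord_{T=0} L_p(E,T) = rank E(ℚ)` at every good ordinary `p`,
`f` the newform of `E`) at an odd good ordinary point from the main conjecture (item stmt-15426),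
`T`-semisimplicity of `X(E/ℚ_∞)` (Greenberg's Conj. 1.12 at `T`, item stmt-0509) and the
cotorsion of `Ш(E/ℚ)[p^∞]` (item stmt-0132), through Mazur's control theorem. This file
kernel-checks that NOTHING IS LOST in that split: modulo the main conjecture and control AT THE
POINT, the crux at the point is EQUIVALENT to `T`-semisimplicity ∧ `Ш[p^∞]`-cotorsion at the point.

* `padicBSDrank_exists_smul_X_smul_eq_zero_of_order_eq` — the commutative algebra: for a finitely
  generated torsion `Λ = ℤ_p⟦T⟧`-module `M` with `char(M) = (f)`, the EQUALITY
  `ord_{T=0} f = rank_{ℤ_p} M/TM` forces `T · M_{(T)} = 0` (every `T m` is killed by a power series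
  with non-zero constant term). Proof by local lengths at `𝔭 = (T)`:
  `rank M/TM ≤ ℓ_𝔭(M) ≤ ord_T f` (tree: `coinvariantsRank_le_lengthAt_primeT`,
  `lengthAt_primeT_le_order`) pins `ℓ_𝔭(M) = rank M/TM`, while `ℓ_𝔭(M) = ℓ_𝔭(TM) + ℓ_𝔭(M/TM)`
  and `ℓ_𝔭(M/TM) = rank_{ℤ_p} M/TM` (`lengthAt_eq_toENat_rank_of_X_smul_eq_zero`); so
  `ℓ_𝔭(TM) = 0`, i.e. `(TM)_𝔭 = 0`. This is the converse of the tree theorem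
  `Greenberg1999_order_charGenerator_eq_coinvariantsRank_holds` (semisimplicity ⇒ equality);
  together: for such `M`, `ord_T f = rank M/TM` **iff** Greenberg's Conj. 1.12 holds at `T`
  (Greenberg, LNM 1716, §1, p. 65: "`rank_{ℤ_p}(X/TX)` … would equal the power of `T` dividing
  `f_E(T)`, assuming the above conjecture" — and only then).
* `padicBSDrank_pPow_semisimple_of_order_eq` — the same in the INTEGRAL spelling of item stmt-0509:
  `p^k T² x = 0 ⇒ p^{k'} T x = 0`.
* `padicBSDrank_semisimple_and_shaCotorsion_of_eq_at_point` — at a point `(E, p, f, κ, γ, D)`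
  carrying the main-conjecture data (`X` torsion, `char X = (g)`, `ι g = p^k L_p(E,T)`) and the
  control identity `rank_{ℤ_p} X/TX = corank Sel_{p^∞}(E/ℚ)`: `ord_T L_p = rank E(ℚ)` implies
  `T`-semisimplicity of `X` (integral spelling) AND `corank_{ℤ_p} Ш(E/ℚ)[p^∞] = 0`. (Sandwich:
  `rank X/TX ≤ ord_T g = ord_T L_p = rank ≤ corank Sel = rank X/TX`.)
* `padicBSDrank_eq_at_point_iff_semisimple_and_shaCotorsion` — with the landed stubs of crux #2's
  line (`stub_ker_mulTRat_sq_eq`, `stub_order_eq_selmerCorank`) the converse holds too: an `iff`.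
* `padicBSDrank_semisimple_of_crux` — globally: the crux ∧ item R7 (stmt-15426) ∧ Mazur control
  imply item stmt-0509 for every cyclotomic datum whose generator matches the variable `T`
  (`IsCyclotomicVariable`), on every curve carrying a newform; i.e. Conj. 1.12 at `T` is a
  NECESSARY input of the crux, exactly as `Ш[p^∞]`-cotorsion is
  (`Negative/ShaCotorsionOfCrux.lean`).
-/

-- D-0017: single-problem summit, so `Summit.BirchSwinnertonDyer.BirchSwinnertonDyer.…` repeats a
-- namespace BY DESIGN.
set_option linter.dupNamespace false

noncomputable section

universe u

namespace Summit.BirchSwinnertonDyer.BirchSwinnertonDyer.Theorems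

open scoped MatrixGroups ModularForm TensorProduct
open CongruenceSubgroup Literature.NumberTheory.EllipticCurves
  Literature.NumberTheory.EllipticCurves.ModularForms
  Literature.NumberTheory.EllipticCurves.IwasawaAlgebra
open Summit.BirchSwinnertonDyer.BirchSwinnertonDyer.Theses.PAdicOrderV2

/-! ## The commutative algebra: `ord_T f = rank M/TM` forces `T · M_{(T)} = 0` -/

/-- **Equality in the structure-theorem inequality forces `T · M_{(T)} = 0`.** Let `M` be a
finitely generated torsion `Λ = ℤ_p⟦T⟧`-module with `char(M) = (f)` and suppose
`ord_{T=0} f = rank_{ℤ_p} M/TM` (`coinvariantsRank`). Then every `T m`, `m ∈ M`, is killed by a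
power series with non-zero constant term. Local lengths at `𝔭 = (T)`:
`rank M/TM ≤ ℓ_𝔭(M) ≤ ord_T f = rank M/TM`, `ℓ_𝔭(M) = ℓ_𝔭(TM) + ℓ_𝔭(M/TM)` and
`ℓ_𝔭(M/TM) ≥ rank M/TM`, whence `ℓ_𝔭(TM) = 0`, i.e. `(TM)_𝔭 = 0`. Converse of Greenberg's remark
after Conj. 1.12 (LNM 1716, §1, p. 65); Washington §13.2. [cite: GreenbergLNM1716, §1 p. 65 (after Conj. 1.12)] -/
theorem padicBSDrank_exists_smul_X_smul_eq_zero_of_order_eq (p : ℕ) [Fact p.Prime]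
    {M : Type u} [AddCommGroup M] [Module (IwasawaAlgebra p) M]
    [Module.Finite (IwasawaAlgebra p) M] (hM : Module.IsTorsion (IwasawaAlgebra p) M)
    (f : IwasawaAlgebra p) (hf : Module.charIdeal (IwasawaAlgebra p) M = Ideal.span {f})
    (heq : f.order = (coinvariantsRank p M : ℕ∞)) (m : M) :
    ∃ u : IwasawaAlgebra p, PowerSeries.constantCoeff u ≠ 0 ∧
      u • (PowerSeries.X : IwasawaAlgebra p) • m = 0 := by
  have h𝔭 : (primeT p).asIdeal = Ideal.span {(PowerSeries.X : IwasawaAlgebra p)} := rfl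
  -- (1) `ℓ_𝔭(M) = rank M/TM`, finite
  have hfin : Module.lengthAt (IwasawaAlgebra p) M (primeT p) ≠ ⊤ := lengthAt_primeT_ne_top M hM
  have hfmem : f ∈ Module.charIdeal (IwasawaAlgebra p) M := by
    rw [hf]
    exact Ideal.mem_span_singleton_self f
  have hℓM : Module.lengthAt (IwasawaAlgebra p) M (primeT p) = (coinvariantsRank p M : ℕ∞) :=
    le_antisymm ((lengthAt_primeT_le_order M hM f hfmem).trans heq.le)
      (coinvariantsRank_le_lengthAt_primeT M)
  -- (2) `ℓ_𝔭(M/TM) ≥ rank M/TM`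
  letI : Module ℤ_[p] (coinvariants p M) :=
    Module.compHom _ (algebraMap ℤ_[p] (IwasawaAlgebra p))
  haveI : IsScalarTower ℤ_[p] (IwasawaAlgebra p) (coinvariants p M) :=
    IsScalarTower.of_compHom ℤ_[p] _ _
  have hT : ∀ q : coinvariants p M, (PowerSeries.X : IwasawaAlgebra p) • q = 0 := by
    intro q
    induction q using Submodule.Quotient.induction_on with
    | H x => rw [← Submodule.Quotient.mk_smul]; exact coinvariants_mk_X_smul p M x
  have hℓQ : (coinvariantsRank p M : ℕ∞) ≤
      Module.lengthAt (IwasawaAlgebra p) (coinvariants p M) (primeT p) := by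
    rw [lengthAt_eq_toENat_rank_of_X_smul_eq_zero p hT (primeT p) h𝔭,
      coinvariantsRank_eq_finrank_int]
    exact ENat.coe_toNat_le_self _
  -- (3) additivity on `0 → TM → M → M/TM → 0` gives `ℓ_𝔭(TM) = 0`
  have hadd := Module.lengthAt_eq_add_of_exact _ _ (Submodule.subtype_injective _)
    (Submodule.mkQ_surjective _)
    (LinearMap.exact_subtype_mkQ (Ideal.span {(PowerSeries.X : IwasawaAlgebra p)} •
      (⊤ : Submodule (IwasawaAlgebra p) M))) (primeT p)
  have hQfin : Module.lengthAt (IwasawaAlgebra p) (coinvariants p M) (primeT p) ≠ ⊤ := by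
    intro htop
    apply hfin
    rw [hadd]
    change _ + Module.lengthAt (IwasawaAlgebra p) (coinvariants p M) (primeT p) = ⊤
    rw [htop, add_top]
  have h0 : Module.lengthAt (IwasawaAlgebra p)
      ↥(Ideal.span {(PowerSeries.X : IwasawaAlgebra p)} • (⊤ : Submodule (IwasawaAlgebra p) M))
        (primeT p) = 0 := by
    have hle : Module.lengthAt (IwasawaAlgebra p)
        ↥(Ideal.span {(PowerSeries.X : IwasawaAlgebra p)} • (⊤ : Submodule (IwasawaAlgebra p) M))
          (primeT p) + Module.lengthAt (IwasawaAlgebra p) (coinvariants p M) (primeT p) ≤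
        0 + Module.lengthAt (IwasawaAlgebra p) (coinvariants p M) (primeT p) := by
      rw [zero_add]
      calc _ = Module.lengthAt (IwasawaAlgebra p) M (primeT p) := hadd.symm
        _ = (coinvariantsRank p M : ℕ∞) := hℓM
        _ ≤ _ := hℓQ
    exact nonpos_iff_eq_zero.mp ((ENat.add_le_add_iff_right hQfin).mp hle)
  -- (4) `(TM)_𝔭 = 0`: witnesses
  rw [Module.lengthAt_eq_zero_iff, LocalizedModule.subsingleton_iff] at h0
  have hmem : (PowerSeries.X : IwasawaAlgebra p) • m ∈
      Ideal.span {(PowerSeries.X : IwasawaAlgebra p)} • (⊤ : Submodule (IwasawaAlgebra p) M) :=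
    Submodule.smul_mem_smul (Ideal.subset_span rfl) Submodule.mem_top
  obtain ⟨u, hu, hum⟩ := h0 ⟨_, hmem⟩
  refine ⟨u, ?_, ?_⟩
  · rw [Ideal.mem_primeCompl_iff, h𝔭, mem_span_X_iff] at hu
    exact hu
  · have := congrArg Subtype.val hum
    simpa using this

/-- **Integral `T`-semisimplicity from `ord_T f = rank M/TM`** (the spelling of item stmt-0509):
under the hypotheses of `padicBSDrank_exists_smul_X_smul_eq_zero_of_order_eq`, if
`p^k T² x = 0` for some `k` then `p^{k'} T x = 0` for some `k'`. With `y = T x`: `u y = 0` with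
`u(0) ≠ 0` and `p^k T y = 0`, so `u` acts on `p^k y` through its constant term, `u(0) p^k y = 0`,
and `u(0) = (unit) · p^j`. [cite: GreenbergLNM1716, §1 p. 65 (after Conj. 1.12)] -/
theorem padicBSDrank_pPow_semisimple_of_order_eq (p : ℕ) [Fact p.Prime]
    {M : Type u} [AddCommGroup M] [Module (IwasawaAlgebra p) M]
    [Module.Finite (IwasawaAlgebra p) M] (hM : Module.IsTorsion (IwasawaAlgebra p) M)
    (f : IwasawaAlgebra p) (hf : Module.charIdeal (IwasawaAlgebra p) M = Ideal.span {f})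
    (heq : f.order = (coinvariantsRank p M : ℕ∞)) (x : M)
    (hx : ∃ k : ℕ, (PowerSeries.C ((p : ℤ_[p]) ^ k) * PowerSeries.X ^ 2 : IwasawaAlgebra p) • x = 0) :
    ∃ k : ℕ, (PowerSeries.C ((p : ℤ_[p]) ^ k) * PowerSeries.X : IwasawaAlgebra p) • x = 0 := by
  obtain ⟨k, hk⟩ := hx
  obtain ⟨u, hu0, hu⟩ := padicBSDrank_exists_smul_X_smul_eq_zero_of_order_eq p hM f hf heq x
  -- `y = T x`, `z = p^k y`
  set y : M := (PowerSeries.X : IwasawaAlgebra p) • x with hy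
  set z : M := (PowerSeries.C ((p : ℤ_[p]) ^ k) : IwasawaAlgebra p) • y with hz
  have hk' : (PowerSeries.C ((p : ℤ_[p]) ^ k) * PowerSeries.X : IwasawaAlgebra p) • y = 0 := by
    rw [hy, smul_smul, mul_assoc, ← pow_two]
    exact hk
  have hXz : (PowerSeries.X : IwasawaAlgebra p) • z = 0 := by
    rw [hz, smul_smul, mul_comm, hk']
  -- `u` acts on `z` through its constant term, and `u z = p^k u y = 0`
  have hC : (PowerSeries.C (PowerSeries.constantCoeff u) : IwasawaAlgebra p) • z = 0 := by
    rw [← smul_eq_C_smul_of_X_smul_eq_zero p u hXz, hz, smul_comm, hu, smul_zero]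
  -- `u(0) = v · p^j` with `v` a unit
  have key : (((PadicInt.unitCoeff hu0)⁻¹ : ℤ_[p]ˣ) : ℤ_[p]) * PowerSeries.constantCoeff u =
      (p : ℤ_[p]) ^ (PowerSeries.constantCoeff u).valuation :=
    (Units.inv_mul_eq_iff_eq_mul _).mpr (PadicInt.unitCoeff_spec hu0)
  refine ⟨k + (PowerSeries.constantCoeff u).valuation, ?_⟩
  have hCeq : (PowerSeries.C ((p : ℤ_[p]) ^ (k + (PowerSeries.constantCoeff u).valuation)) :
      IwasawaAlgebra p) =
      PowerSeries.C (((PadicInt.unitCoeff hu0)⁻¹ : ℤ_[p]ˣ) : ℤ_[p]) *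
        PowerSeries.C (PowerSeries.constantCoeff u) * PowerSeries.C ((p : ℤ_[p]) ^ k) := by
    rw [← map_mul, ← map_mul, pow_add, ← key]
    congr 1
    ring
  rw [mul_smul]
  change (PowerSeries.C ((p : ℤ_[p]) ^ (k + (PowerSeries.constantCoeff u).valuation)) :
    IwasawaAlgebra p) • y = 0
  rw [hCeq, mul_smul, mul_smul]
  change (PowerSeries.C (((PadicInt.unitCoeff hu0)⁻¹ : ℤ_[p]ˣ) : ℤ_[p]) : IwasawaAlgebra p) •
    (PowerSeries.C (PowerSeries.constantCoeff u) : IwasawaAlgebra p) • z = 0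
  rw [hC, smul_zero]

/-! ## At a point of the crux -/

/-- **The crux at a point forces `T`-semisimplicity and `Ш[p^∞]`-cotorsion at that point.** Let
`E/ℚ` (globally minimal `W`), `p` a prime, `f` a cusp form, `κ` cyclotomic with topological
generator `γ`, `D` a dual datum with `X = D.X` torsion, and assume the main-conjecture data
`char_Λ X = (g)`, `ι g = p^k · L_p` (`L_p = padicLFunction f (unitRoot W p)`) and the control
identity `rank_{ℤ_p} X/TX = corank_{ℤ_p} Sel_{p^∞}(E/ℚ)`. If `ord_{T=0} L_p = rank E(ℚ)` then
(i) `T` acts semisimply on `X` at `T = 0` (integral spelling of item stmt-0509) and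
(ii) `corank_{ℤ_p} Ш(E/ℚ)[p^∞] = 0`. Sandwich: `rank X/TX ≤ ord_T g`
(`coinvariantsRank_le_order_of_mem_charIdeal`) `= ord_T L_p = rank ≤ corank Sel`
(`selmerCorank_eq_mordellWeilRank_add_holds`) `= rank X/TX`, so all are equal; (i) is then
`padicBSDrank_pPow_semisimple_of_order_eq`. [cite: GreenbergLNM1716, §1 Conj. 1.12 and p. 65] -/
theorem padicBSDrank_semisimple_and_shaCotorsion_of_eq_at_point
    (W : WeierstrassCurve ℚ) [W.IsElliptic] [W.IsGloballyMinimal] (p : ℕ) [Fact p.Prime]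
    {N : ℕ} (f : CuspForm (Gamma0 N) 2)
    {κ : ZpExtension ℚ p} {γ : Field.absoluteGaloisGroup ℚ} (hκ : κ.IsCyclotomic)
    (hγ : κ.IsTopGenerator γ) (D : W.SelmerDualData κ γ) (htors : D.IsTorsion)
    (hmc : ∃ (g : IwasawaAlgebra p) (k : ℤ), D.charIdeal = Ideal.span {g} ∧
      iwasawaToPowerSeries p g =
        PowerSeries.C ((p : ℚ_[p]) ^ k) * padicLFunction f (unitRoot W p : ℚ_[p]))
    (hctrl : coinvariantsRank p D.X = W.selmerCorank p)
    (hS : (padicLFunction f (unitRoot W p : ℚ_[p])).order = W.mordellWeilRank) :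
    (∀ x : D.X, (∃ k : ℕ, (PowerSeries.C ((p : ℤ_[p]) ^ k) * PowerSeries.X ^ 2 :
        IwasawaAlgebra p) • x = 0) →
      ∃ k : ℕ, (PowerSeries.C ((p : ℤ_[p]) ^ k) * PowerSeries.X : IwasawaAlgebra p) • x = 0) ∧
    W.shaCorank p = 0 := by
  obtain ⟨g, k, hg, hι⟩ := hmc
  haveI : Module.Finite (IwasawaAlgebra p) D.X := D.module_finite_of_isCyclotomic W κ hκ hγ
  -- `ord_T g = ord_T L_p`
  have hpk : IsUnit (PowerSeries.C ((p : ℚ_[p]) ^ k)) := by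
    refine IsUnit.map PowerSeries.C (IsUnit.mk0 _ (zpow_ne_zero k ?_))
    exact_mod_cast (Fact.out : p.Prime).ne_zero
  have h2 : (iwasawaToPowerSeries p g).order = g.order :=
    bk_order_map_of_injective (algebraMap ℤ_[p] ℚ_[p]) (IsFractionRing.injective ℤ_[p] ℚ_[p]) g
  have hordg : g.order = (W.mordellWeilRank : ℕ∞) := by
    rw [← h2, hι, PowerSeries.order_mul, PowerSeries.order_zero_of_unit hpk, zero_add, hS]
  -- the sandwich
  have hle : (coinvariantsRank p D.X : ℕ∞) ≤ g.order :=
    coinvariantsRank_le_order_of_mem_charIdeal D.X htors g (by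
      change g ∈ D.charIdeal
      rw [hg]
      exact Ideal.mem_span_singleton_self g)
  rw [hordg] at hle
  have hle' : coinvariantsRank p D.X ≤ W.mordellWeilRank := by exact_mod_cast hle
  have hid := W.selmerCorank_eq_mordellWeilRank_add_holds p
  have hrank : W.mordellWeilRank = coinvariantsRank p D.X := by omega
  refine ⟨fun x hx ↦ ?_, by omega⟩
  exact padicBSDrank_pPow_semisimple_of_order_eq p htors g hg (by rw [hordg, hrank]) x hx

/-- **At a point carrying the main conjecture and control, the crux is EXACTLY semisimplicity ∧
`Ш[p^∞]`-cotorsion.** Under the hypotheses of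
`padicBSDrank_semisimple_and_shaCotorsion_of_eq_at_point` (with `N ≠ 0`):
`ord_{T=0} L_p = rank E(ℚ)` **iff** `T` acts semisimply on `X` at `T = 0` (integral spelling of
item stmt-0509) **and** `corank_{ℤ_p} Ш(E/ℚ)[p^∞] = 0`. The direction `⇐` is the landed
bookkeeping of crux #2's line (`stub_ker_mulTRat_sq_eq`, `stub_order_eq_selmerCorank`:
`ord_T L_p = corank Sel`) plus the corank identity. [cite: GreenbergLNM1716, §1 Conj. 1.12 and p. 65] -/
theorem padicBSDrank_eq_at_point_iff_semisimple_and_shaCotorsion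
    (W : WeierstrassCurve ℚ) [W.IsElliptic] [W.IsGloballyMinimal] (p : ℕ) [Fact p.Prime]
    {N : ℕ} [NeZero N] (f : CuspForm (Gamma0 N) 2)
    {κ : ZpExtension ℚ p} {γ : Field.absoluteGaloisGroup ℚ} (hκ : κ.IsCyclotomic)
    (hγ : κ.IsTopGenerator γ) (D : W.SelmerDualData κ γ) (htors : D.IsTorsion)
    (hmc : ∃ (g : IwasawaAlgebra p) (k : ℤ), D.charIdeal = Ideal.span {g} ∧
      iwasawaToPowerSeries p g =
        PowerSeries.C ((p : ℚ_[p]) ^ k) * padicLFunction f (unitRoot W p : ℚ_[p]))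
    (hctrl : coinvariantsRank p D.X = W.selmerCorank p) :
    (padicLFunction f (unitRoot W p : ℚ_[p])).order = W.mordellWeilRank ↔
      (∀ x : D.X, (∃ k : ℕ, (PowerSeries.C ((p : ℤ_[p]) ^ k) * PowerSeries.X ^ 2 :
          IwasawaAlgebra p) • x = 0) →
        ∃ k : ℕ, (PowerSeries.C ((p : ℤ_[p]) ^ k) * PowerSeries.X : IwasawaAlgebra p) • x = 0) ∧
      W.shaCorank p = 0 := by
  refine ⟨padicBSDrank_semisimple_and_shaCotorsion_of_eq_at_point W p f hκ hγ D htors hmc hctrl,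
    fun ⟨hssInt, hsha⟩ ↦ ?_⟩
  have hss := stub_ker_mulTRat_sq_eq p D.X hssInt
  rw [stub_order_eq_selmerCorank W p κ γ hκ hγ f D htors hmc hss hctrl,
    W.selmerCorank_eq_mordellWeilRank_add_holds p, hsha, Nat.add_zero]

/-! ## Globally: the crux forces Greenberg's Conj. 1.12 at `T` (variable-matched data) -/

/-- **The crux, with Mazur's main conjecture (item stmt-15426) and Mazur control, implies
`T`-semisimplicity** — item stmt-0509 `PAdicOrderSemisimpleR3` restricted to cyclotomic data whose
generator matches the variable `T` (`IsCyclotomicVariable`, the shape in which R7 is stated) and to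
curves carrying a newform `f`: for every `E/ℚ` (globally minimal `W`), odd good ordinary `p`,
such `κ, γ`, dual datum `D` and `x ∈ X = D.X`, `p^k T² x = 0 ⇒ p^{k'} T x = 0`. So Conj. 1.12 at
`T` is a NECESSARY input of the crux modulo IMC ∧ control, as `Ш[p^∞]`-cotorsion is modulo Kato.
[cite: GreenbergLNM1716, §1 Conj. 1.12–1.13 and p. 65] -/
theorem padicBSDrank_semisimple_of_crux :
    Summit.BirchSwinnertonDyer.BirchSwinnertonDyer.Theses.PAdicOrderV2.PAdicOrderPadicBSDrankR2 →
    Summit.BirchSwinnertonDyer.BirchSwinnertonDyer.Theses.PAdicOrderV2.PAdicOrderMainConjectureR7 →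
    Literature.NumberTheory.EllipticCurves.Greenberg1999_coinvariantsRank_eq_selmerCorank_rat →
    ∀ (W : WeierstrassCurve ℚ) [W.IsElliptic] [W.IsGloballyMinimal] (p : ℕ) [Fact p.Prime],
      p ≠ 2 → Literature.NumberTheory.EllipticCurves.IsOrdinaryAt W p →
      ∀ {N : ℕ} [NeZero N] (f : CuspForm (CongruenceSubgroup.Gamma0 N) 2),
      Literature.NumberTheory.EllipticCurves.ModularForms.IsNewformOf W f →
      ∀ (κ : Literature.NumberTheory.EllipticCurves.ZpExtension ℚ p) (γ : Field.absoluteGaloisGroup ℚ),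
      κ.IsCyclotomic → κ.IsTopGenerator γ →
      Literature.NumberTheory.EllipticCurves.IsCyclotomicVariable p γ →
      ∀ (D : W.SelmerDualData κ γ) (x : D.X),
      (∃ k : ℕ, (PowerSeries.C ((p : ℤ_[p]) ^ k) * PowerSeries.X ^ 2 :
          Literature.NumberTheory.EllipticCurves.IwasawaAlgebra p) • x = 0) →
        ∃ k : ℕ, (PowerSeries.C ((p : ℤ_[p]) ^ k) * PowerSeries.X :
          Literature.NumberTheory.EllipticCurves.IwasawaAlgebra p) • x = 0 := by
  intro hS hMC hCT W _ _ p _ hp2 hord N _ f hf κ γ hκ hγ hγ' D x hx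
  have hp3 : 3 ≤ p := by
    have := (Fact.out : p.Prime).two_le
    omega
  obtain ⟨htors, hmc⟩ := hMC W p hp3 hord.1 hord.2 κ γ hκ hγ hγ' f hf D
  have hctrl := (hCT W p hord.1 hord.2 κ γ hκ hγ D).2
  exact (padicBSDrank_semisimple_and_shaCotorsion_of_eq_at_point W p f hκ hγ D htors hmc hctrl
    (hS W p hord f hf)).1 x hx

end Summit.BirchSwinnertonDyer.BirchSwinnertonDyer.Theorems

end
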